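import Mathlib
import Literature.MathematicalPhysics.QuantumFieldTheory.BalabanImbrieJaffe1984to88.BIJ85AxialPropagator411

/-!
# `BalabanImbrieJaffe1984to88.BIJ85AxialMinimizer413` — T. Bałaban, J. Imbrie, A. Jaffe, *Renormalization of the Higgs
model: minimizers, propagators and the stability of mean field theory*, Commun. Math. Phys. **97** (1985) 299–329
[BalabanImbrieJaffe1985]: Sect. 4.1 p. 309–310 — the axial gauge minimizer `H_{k,Ax}` (4.1.3)–(4.1.4) typed as printed and
EVALUATED, **(4.1.5) `Q_kH_{k,Ax}B = B` PROVED**, the minimizing property PROVED; the computation behind (5.3.1) p. 317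

statement-level skeleton of published theorems with citation tags; proofs where landed; nothing here is a claim about the Yang–Mills mass gap

PDF held: `paper:balaban1985-cmp97-bij-higgs-minimizers` (journal page = PDF page + 298); p. 309–310 [PDF 11–12] read on the
renders `run/shared/lean/pub/pub-balaban/t4/b2b-balaban-t4-lit2/renders/bij1985/1985-cmp97-bij-higgs-minimizers-p011-x2.png`,
`…-p012-x2.png`; p. 317 [PDF 19] from the OCR text (`lit read paper:balaban1985-cmp97-bij-higgs-minimizers --pages 19`).

THE PRINTED TEXT (p. 309–310, verbatim).  *"Another aspect of the action S_G(A) = ½‖∂A‖² concerns what configurations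
minimize S_G(A) subject to the constraints of a gauge condition and a condition that the average field Q_kA equals a given
value B. We introduce a transformation H_{k,Ax} which maps B into such a minimizing configuration for axial gauge, and we
call H_{k,Ax} the axial gauge minimizer. Explicitly, H_{k,Ax}B = Z_{k,Ax}(B)^{−1}∫𝒟Aδ(Q_kA − B)δ_{k,Ax}(A)A exp(−½‖∂A‖²),
(4.1.3) where Z_{k,Ax}(B) = ∫𝒟Aδ(Q_kA − B)δ_{k,Ax}(A)exp(−½‖∂A‖²). (4.1.4) Note that by definition Q_kH_{k,Ax}B = B.
(4.1.5)"*.  And p. 317: *"we need one more identity, namely H_{k,Ax}B = Q^{s*}_kB − G_{k,Ax}∂^*Q^{e*}_k∂B. (5.3.1) This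
identity follows by inspecting the definition (4.1.3) after the translation A = A′ + Q^{s*}_kB. Use the facts Q_kQ^{s*}_k = I
and ∂Q^{s*}_kB = Q^{e*}_k∂B … The second term yields Q^{s*}_kB. In the first term we translate to the minimum of the quadratic
form which is G_{k,Ax}∂^*Q^{e*}_k∂B. We see this by integrating."*

WHAT IS TYPED / PROVED (SKELETON row `C1.Eq4.1.3-4.1.5`, whose cells of record so far were the carrier field
`BIJ85Sect4Statements.GaugeRG.Hax` and the Prop `GaugeRG.Eq415`; lit-balaban HOME `run/shared/lean/pub/lit-balaban/`, Phase-2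
seat p09 — G.5-34(d) taking, announced 2026-08-21T01:12Z; unit `lit-balaban-p09`).  The setting is that of
`…BIJ85AxialPropagator411` §2: η-bond fields = a finite-dimensional real inner product space `E`, the curl `D : E → F`, the
LINEAR constraint subspace `V ⊆ E` (support of `δ(Q_kA)δ_{k,Ax}(A)`), and a representative `A₀` of the AFFINE constraint
class `{δ_{k,Ax}(A), Q_kA = B} = A₀ + V`.
* §1 — the minimizing configuration `minimizer V D A₀ = A₀ − G_{k,Ax}(∂^*∂A₀)` (`G_{k,Ax}` = `axialPropagator V D`): it lies
  in the class (`minimizer_sub_mem`), satisfies the Euler–Lagrange equation `⟨∂M, ∂v⟩ = 0, v ∈ V` (`inner_D_minimizer`),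
  Pythagoras `‖∂(M+v)‖² = ‖∂M‖² + ‖∂v‖²` (`norm_sq_D_minimizer_add`), MINIMIZES `‖∂A‖` on the class (`norm_D_minimizer_le`)
  UNIQUELY (`eq_minimizer_of_norm_le`), and depends only on the class (`minimizer_congr`) — all given no zero modes of ∂ on V.
* §2 — **(4.1.4)** `Zax V D A₀ = ∫_V e^{−½‖∂(A₀+v)‖²}dv` and **(4.1.3)** `Hax V D A₀ = Zax⁻¹ ∫_V (A₀+v) e^{−½‖∂(A₀+v)‖²}dv`
  (Bochner integral in E), typed VERBATIM; both depend only on the class (`Zax_congr`, `Hax_congr`: translation invariance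
  of the volume, unconditionally); given no zero modes: `Zax = e^{−½‖∂M‖²}·Z_{k,Ax} > 0` (`Zax_eq`, `Zax_pos`), the first
  moment converges (`moment_integrable`) and is odd (`moment_zero`), hence **`Hax_eq_minimizer : Hax V D A₀ = minimizer V D A₀`**
  — the printed "translate to the minimum of the quadratic form … we see this by integrating" — and from it **(4.1.5)**
  `eq415 : Q (Hax V D A₀) = Q A₀` for every linear `Q` killing V (in print Q_k; also the gauge functionals of δ_{k,Ax}),
  `Hax_sub_mem`, the minimizing property `norm_D_Hax_le` / `eq_Hax_of_norm_le`, and the (5.3.1) shape `eq531_shape`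
  (`H(Qs B) = Qs B − G_{k,Ax}∂^*(T B)` whenever `∂(Qs B) = T B`; the torus identities `Q_kQ^{s*}_k = I`, `∂Q^{s*}_k = Q^{e*}_k∂`
  themselves are rows C1.Eq2.19 / C1.Eq2.24, not used here).
* §3 — ON THE TORI of `…Balaban1983to89.LatticeFieldCalculus` (as `…BIJ85AxialPropagator411` §4: `E = BondSpace P`, pairing
  `bondPairing w` with `w = η^d`, `½‖∂A‖² = curlAction w c`, `V = V411 P k` = `constraint411 k`): `torusHax`, `torusZax`, the
  verbatim integral readings `torusZax_eq` / `torusHax_eq_integral`, `torusHax_congr`, and — given the p. 309 no-zero-modes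
  claim as the hypothesis `hD` (k = 1 proved on ℤ^d carriers by `…BIJ85NoZeroModes309Proof.noZeroModes_k1`, p33) —
  **`torus_eq415`**: `bondAvgIter k (torusHax w c k A₀) = bondAvgIter k A₀` and `deltaAx k A₀ → deltaAx k (torusHax w c k A₀)`,
  `torus_minimizes` (curlAction of `H_{k,Ax}B` ≤ that of any A in the class), `torusZax_pos`.
NOT DONE HERE.  The existence of a representative for EVERY unit-lattice field B (in print `Q^{s*}_kB`, (2.17)/(2.19)) is not
re-proved: the statements are parametrised by the representative `A₀` (one-step `QQ^{s*} = I` on the tori is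
`…BIJ85Eq219Proof.bondAvg_Qsstar`, seat p31).  No new `def … : Prop`; nothing is asserted beyond the kernel-checked algebra
and integrals.
-/

namespace Literature.MathematicalPhysics.QuantumFieldTheory.BalabanImbrieJaffe1984to88.BIJ85AxialMinimizer413

open MeasureTheory
open scoped RealInnerProductSpace
open BIJ85AxialPropagator411

noncomputable section

/-! ## §1  The minimizing configuration `A₀ − G_{k,Ax}(∂^*∂A₀)` (pure linear algebra) -/

section Minimizer

variable {E F : Type*} [NormedAddCommGroup E] [InnerProductSpace ℝ E] [NormedAddCommGroup F] [InnerProductSpace ℝ F]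

/-- No zero modes of D on V ⇒ `S = D ι_V` is injective. [folklore] -/
private theorem injective_S {V : Submodule ℝ E} {D : E →ₗ[ℝ] F} (hD : ∀ v : V, D (v : E) = 0 → v = 0) :
    Function.Injective (D ∘ₗ V.subtype) := by
  intro v w h
  have : (D ∘ₗ V.subtype) (v - w) = 0 := by rw [map_sub, h, sub_self]
  exact sub_eq_zero.1 (hD _ this)

variable [FiniteDimensional ℝ E] [FiniteDimensional ℝ F]

/-- **The minimizing configuration** (p. 309–310, verbatim: *"Another aspect of the action S_G(A) = ½‖∂A‖² concerns what
configurations minimize S_G(A) subject to the constraints of a gauge condition and a condition that the average field Q_kA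
equals a given value B. We introduce a transformation H_{k,Ax} which maps B into such a minimizing configuration for axial
gauge, and we call H_{k,Ax} the axial gauge minimizer"*; the shape printed in (5.3.1) p. 317: *"we translate to the minimum of
the quadratic form which is G_{k,Ax}∂^*Q^{e*}_k∂B"*): for a representative `A₀` of the constraint class `A₀ + V`,
`A₀ − G_{k,Ax}(∂^*∂A₀)` with `G_{k,Ax} = ι_V(ι_V*∂*∂ι_V)⁻¹ι_V*` = `…BIJ85AxialPropagator411.axialPropagator`.
[cite: BalabanImbrieJaffe1985, (4.1.3) p.310] -/
def minimizer (V : Submodule ℝ E) (D : E →ₗ[ℝ] F) (A₀ : E) : E :=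
  A₀ - axialPropagator V D (LinearMap.adjoint D (D A₀))

/-- The minimizing configuration lies in the constraint class of `A₀`: `A₀ − M ∈ V`. [cite: BalabanImbrieJaffe1985, (4.1.3)–(4.1.5) p.310] -/
theorem sub_minimizer_mem (V : Submodule ℝ E) (D : E →ₗ[ℝ] F) (A₀ : E) : A₀ - minimizer V D A₀ ∈ V := by
  unfold minimizer axialPropagator
  simp only [sub_sub_cancel, LinearMap.comp_apply, Submodule.subtype_apply]
  exact Submodule.coe_mem _

/-- `M − A₀ ∈ V`. [cite: BalabanImbrieJaffe1985, (4.1.3)–(4.1.5) p.310] -/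
theorem minimizer_sub_mem (V : Submodule ℝ E) (D : E →ₗ[ℝ] F) (A₀ : E) : minimizer V D A₀ - A₀ ∈ V := by
  rw [← neg_sub]
  exact V.neg_mem (sub_minimizer_mem V D A₀)

/-- `⟨Sx, Sv⟩ = ⟨S*S x, v⟩` for `S = D ι_V`. [folklore] -/
private theorem inner_S_S (V : Submodule ℝ E) (D : E →ₗ[ℝ] F) (x v : V) :
    ⟪(D ∘ₗ V.subtype) x, (D ∘ₗ V.subtype) v⟫ = ⟪formOp (D ∘ₗ V.subtype) x, v⟫ := by
  unfold formOp
  rw [LinearMap.comp_apply (LinearMap.adjoint _), LinearMap.adjoint_inner_left]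

/-- **Euler–Lagrange equation of the constrained minimum**: `⟨∂M, ∂v⟩ = 0` for every `v` in the constraint subspace (no zero
modes of ∂ on V). [cite: BalabanImbrieJaffe1985, (4.1.3) p.310] -/
theorem inner_D_minimizer {V : Submodule ℝ E} {D : E →ₗ[ℝ] F} (hD : ∀ v : V, D (v : E) = 0 → v = 0) (A₀ : E) (v : V) :
    ⟪D (minimizer V D A₀), D (v : E)⟫ = 0 := by
  set S : V →ₗ[ℝ] F := D ∘ₗ V.subtype with hS
  have hSinj : Function.Injective S := injective_S hD
  set b : V := LinearMap.adjoint V.subtype (LinearMap.adjoint D (D A₀)) with hb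
  have h1 : minimizer V D A₀ = A₀ - ((formInv S b : V) : E) := by
    simp only [minimizer, axialPropagator, LinearMap.comp_apply, Submodule.subtype_apply, hS, hb]
  have h2 : ⟪D ((formInv S b : V) : E), D (v : E)⟫ = ⟪D A₀, D (v : E)⟫ := by
    have : ⟪S (formInv S b), S v⟫ = ⟪b, v⟫ := by rw [inner_S_S, formOp_formInv hSinj]
    simp only [hS, LinearMap.comp_apply, Submodule.subtype_apply] at this
    rw [this, hb, LinearMap.adjoint_inner_left, Submodule.subtype_apply, LinearMap.adjoint_inner_left]
  rw [h1, map_sub, inner_sub_left, h2, sub_self]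

/-- **Pythagoras at the minimum**: `‖∂(M + v)‖² = ‖∂M‖² + ‖∂v‖²` for `v ∈ V`. [cite: BalabanImbrieJaffe1985, (4.1.3) p.310] -/
theorem norm_sq_D_minimizer_add {V : Submodule ℝ E} {D : E →ₗ[ℝ] F} (hD : ∀ v : V, D (v : E) = 0 → v = 0) (A₀ : E)
    (v : V) : ‖D (minimizer V D A₀ + (v : E))‖ ^ 2 = ‖D (minimizer V D A₀)‖ ^ 2 + ‖D (v : E)‖ ^ 2 := by
  rw [map_add, @norm_add_sq_real, inner_D_minimizer hD A₀ v, mul_zero, add_zero]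

/-- **The minimizing property**: for every `A` of the constraint class (`A − A₀ ∈ V`), `‖∂M‖ ≤ ‖∂A‖`.
[cite: BalabanImbrieJaffe1985, (4.1.3) p.310] -/
theorem norm_D_minimizer_le {V : Submodule ℝ E} {D : E →ₗ[ℝ] F} (hD : ∀ v : V, D (v : E) = 0 → v = 0) (A₀ : E)
    {A : E} (hA : A - A₀ ∈ V) : ‖D (minimizer V D A₀)‖ ≤ ‖D A‖ := by
  have hv : A - minimizer V D A₀ ∈ V := by
    have := V.add_mem hA (sub_minimizer_mem V D A₀)
    simpa using this
  have h := norm_sq_D_minimizer_add hD A₀ ⟨A - minimizer V D A₀, hv⟩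
  simp only [add_sub_cancel] at h
  have h' : ‖D (minimizer V D A₀)‖ ^ 2 ≤ ‖D A‖ ^ 2 := by rw [h]; exact le_add_of_nonneg_right (sq_nonneg _)
  exact (pow_le_pow_iff_left₀ (norm_nonneg _) (norm_nonneg _) two_ne_zero).1 h'

/-- **The minimum is unique** on the constraint class (no zero modes): `‖∂A‖ ≤ ‖∂M‖` forces `A = M`.
[cite: BalabanImbrieJaffe1985, (4.1.3) p.310] -/
theorem eq_minimizer_of_norm_le {V : Submodule ℝ E} {D : E →ₗ[ℝ] F} (hD : ∀ v : V, D (v : E) = 0 → v = 0) (A₀ : E)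
    {A : E} (hA : A - A₀ ∈ V) (hle : ‖D A‖ ≤ ‖D (minimizer V D A₀)‖) : A = minimizer V D A₀ := by
  have hv : A - minimizer V D A₀ ∈ V := by
    have := V.add_mem hA (sub_minimizer_mem V D A₀)
    simpa using this
  have h := norm_sq_D_minimizer_add hD A₀ ⟨A - minimizer V D A₀, hv⟩
  simp only [add_sub_cancel] at h
  have hsq : ‖D A‖ ^ 2 ≤ ‖D (minimizer V D A₀)‖ ^ 2 := pow_le_pow_left₀ (norm_nonneg _) hle 2
  have h0 : ‖D (A - minimizer V D A₀)‖ ^ 2 = 0 := by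
    have := sq_nonneg ‖D (A - minimizer V D A₀)‖
    linarith
  have h1 : D (((⟨A - minimizer V D A₀, hv⟩ : V)) : E) = 0 := by
    have := pow_eq_zero_iff (n := 2) (by norm_num) |>.1 h0
    exact norm_eq_zero.1 this
  have h2 := hD _ h1
  have h3 : A - minimizer V D A₀ = 0 := by
    have := congrArg (fun v : V => (v : E)) h2
    simpa using this
  exact sub_eq_zero.1 h3

/-- The minimizer of a class does not depend on the representative: `M(A₀ + v) = M(A₀)` for `v ∈ V` (uniqueness).
[cite: BalabanImbrieJaffe1985, (4.1.3) p.310] -/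
theorem minimizer_congr {V : Submodule ℝ E} {D : E →ₗ[ℝ] F} (hD : ∀ v : V, D (v : E) = 0 → v = 0) {A₀ A₁ : E}
    (h : A₁ - A₀ ∈ V) : minimizer V D A₁ = minimizer V D A₀ := by
  have h1 : minimizer V D A₁ - A₀ ∈ V := by
    have := V.add_mem (minimizer_sub_mem V D A₁) h
    simpa using this
  have h0 : minimizer V D A₀ - A₁ ∈ V := by
    have := V.sub_mem (minimizer_sub_mem V D A₀) h
    have e : minimizer V D A₀ - A₀ - (A₁ - A₀) = minimizer V D A₀ - A₁ := by abel
    rwa [e] at this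
  have hle₁ : ‖D (minimizer V D A₀)‖ ≤ ‖D (minimizer V D A₁)‖ := norm_D_minimizer_le hD A₀ h1
  have hle₂ : ‖D (minimizer V D A₁)‖ ≤ ‖D (minimizer V D A₀)‖ := norm_D_minimizer_le hD A₁ h0
  exact eq_minimizer_of_norm_le hD A₀ h1 (le_antisymm hle₂ hle₁ ▸ le_rfl)

/-- In particular `M` is its own minimizer. [cite: BalabanImbrieJaffe1985, (4.1.3) p.310] -/
theorem minimizer_minimizer {V : Submodule ℝ E} {D : E →ₗ[ℝ] F} (hD : ∀ v : V, D (v : E) = 0 → v = 0) (A₀ : E) :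
    minimizer V D (minimizer V D A₀) = minimizer V D A₀ :=
  minimizer_congr hD (minimizer_sub_mem V D A₀)

end Minimizer

/-! ## §2  (4.1.3)–(4.1.5): `H_{k,Ax}B` as the constrained Gaussian mean, evaluated -/

section Gaussian

variable {E F : Type*} [NormedAddCommGroup E] [InnerProductSpace ℝ E] [FiniteDimensional ℝ E]
  [MeasurableSpace E] [BorelSpace E]
  [NormedAddCommGroup F] [InnerProductSpace ℝ F]

/-- **(4.1.4)** verbatim: *"Z_{k,Ax}(B) = ∫𝒟Aδ(Q_kA − B)δ_{k,Ax}(A)exp(−½‖∂A‖²). (4.1.4)"* — the integral of `e^{−½‖∂A‖²}` over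
the AFFINE constraint space `{A : δ_{k,Ax}(A), Q_kA = B} = A₀ + V` (`A₀` any representative, `V` the linear constraint subspace
`δ(Q_kA)δ_{k,Ax}(A)` of (4.1.1)), for the volume of V carried to `A₀ + V`. [cite: BalabanImbrieJaffe1985, (4.1.4) p.310] -/
def Zax (V : Submodule ℝ E) (D : E →ₗ[ℝ] F) (A₀ : E) : ℝ :=
  ∫ v : V, Real.exp (-(1 / 2) * ‖D (A₀ + (v : E))‖ ^ 2)

/-- **(4.1.3)** verbatim: *"Explicitly, H_{k,Ax}B = Z_{k,Ax}(B)^{−1}∫𝒟Aδ(Q_kA − B)δ_{k,Ax}(A)A exp(−½‖∂A‖²), (4.1.3)"* — the MEAN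
of the Gaussian measure `e^{−½‖∂A‖²}𝒟A` restricted to the affine constraint space `A₀ + V` (a Bochner integral with values in
the bond fields E). [cite: BalabanImbrieJaffe1985, (4.1.3) p.310] -/
def Hax (V : Submodule ℝ E) (D : E →ₗ[ℝ] F) (A₀ : E) : E :=
  (Zax V D A₀)⁻¹ • ∫ v : V, Real.exp (-(1 / 2) * ‖D (A₀ + (v : E))‖ ^ 2) • (A₀ + (v : E))

/-- **Independence of the representative**: `Z_{k,Ax}(B)` depends only on the constraint class `A₀ + V` (translation
invariance of the volume of V). [cite: BalabanImbrieJaffe1985, (4.1.4) p.310] -/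
theorem Zax_congr (V : Submodule ℝ E) (D : E →ₗ[ℝ] F) {A₀ A₁ : E} (h : A₁ - A₀ ∈ V) : Zax V D A₁ = Zax V D A₀ := by
  unfold Zax
  have key := integral_add_left_eq_self (μ := (volume : Measure V))
    (fun v : V => Real.exp (-(1 / 2) * ‖D (A₀ + (v : E))‖ ^ 2)) ⟨A₁ - A₀, h⟩
  simp only [Submodule.coe_add] at key
  rw [← key]
  refine integral_congr_ae (Filter.Eventually.of_forall fun v => ?_)
  have : A₀ + (A₁ - A₀ + (v : E)) = A₁ + (v : E) := by abel
  simp only [this]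

/-- `H_{k,Ax}B` depends only on the constraint class `A₀ + V` of the representative — (4.1.3) is a function of B.
[cite: BalabanImbrieJaffe1985, (4.1.3) p.310] -/
theorem Hax_congr (V : Submodule ℝ E) (D : E →ₗ[ℝ] F) {A₀ A₁ : E} (h : A₁ - A₀ ∈ V) : Hax V D A₁ = Hax V D A₀ := by
  unfold Hax
  rw [Zax_congr V D h]
  congr 1
  have key := integral_add_left_eq_self (μ := (volume : Measure V))
    (fun v : V => Real.exp (-(1 / 2) * ‖D (A₀ + (v : E))‖ ^ 2) • (A₀ + (v : E))) ⟨A₁ - A₀, h⟩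
  simp only [Submodule.coe_add] at key
  rw [← key]
  refine integral_congr_ae (Filter.Eventually.of_forall fun v => ?_)
  have : A₀ + (A₁ - A₀ + (v : E)) = A₁ + (v : E) := by abel
  simp only [this]

/-- **The odd moment vanishes**: `∫_V e^{−½‖∂v‖²} v dv = 0` (the volume of V is invariant under `v ↦ −v`).
[cite: BalabanImbrieJaffe1985, (4.1.3) p.310] -/
theorem moment_zero (V : Submodule ℝ E) (D : E →ₗ[ℝ] F) :
    ∫ v : V, Real.exp (-(1 / 2) * ‖D (v : E)‖ ^ 2) • (v : E) = 0 := by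
  set f : V → E := fun v => Real.exp (-(1 / 2) * ‖D (v : E)‖ ^ 2) • (v : E) with hf
  have hneg : ∀ v : V, f (-v) = -f v := by
    intro v
    simp only [hf, Submodule.coe_neg, map_neg, norm_neg, smul_neg]
  have h1 : ∫ v : V, f (-v) = ∫ v : V, f v := integral_neg_eq_self f volume
  have h2 : ∫ v : V, f (-v) = -∫ v : V, f v := by
    rw [← integral_neg]
    exact integral_congr_ae (Filter.Eventually.of_forall hneg)
  have h3 : ∫ v : V, f v = -∫ v : V, f v := h1.symm.trans h2
  have h4 : (2 : ℝ) • ∫ v : V, f v = 0 := by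
    rw [two_smul]
    nth_rewrite 2 [h3]
    exact add_neg_cancel _
  exact (smul_eq_zero.1 h4).resolve_left two_ne_zero

omit [MeasurableSpace E] [BorelSpace E] in
/-- A linear bound `‖v‖ ≤ K‖Sv‖` for injective `S` (finite dimension). [folklore] -/
private theorem exists_bound {V : Submodule ℝ E} {S : V →ₗ[ℝ] F} (hS : Function.Injective S) :
    ∃ K : ℝ, 0 ≤ K ∧ ∀ w, ‖w‖ ≤ K * ‖S w‖ := by
  let e : V ≃L[ℝ] LinearMap.range S := (LinearEquiv.ofInjective S hS).toContinuousLinearEquiv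
  refine ⟨‖(e.symm : LinearMap.range S →L[ℝ] V)‖₊, NNReal.coe_nonneg _, fun w => ?_⟩
  have h := e.antilipschitz.le_mul_dist w 0
  rw [dist_zero_right, map_zero, dist_zero_right] at h
  exact h

/-- `t·e^{−t²/4} ≤ 1`. [folklore] -/
private theorem mul_exp_neg_sq_le (t : ℝ) : t * Real.exp (-(t ^ 2 / 4)) ≤ 1 := by
  have h1 : t ≤ Real.exp (t ^ 2 / 4) := by
    have := Real.add_one_le_exp (t ^ 2 / 4)
    nlinarith [sq_nonneg (t / 2 - 1)]
  rw [Real.exp_neg]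
  have h2 : 0 < Real.exp (t ^ 2 / 4) := Real.exp_pos _
  rw [mul_inv_le_iff₀ h2, one_mul]
  exact h1

/-- **Convergence of the first moment**: `v ↦ e^{−½‖∂v‖²}·v` is Bochner-integrable on V when ∂ has no zero modes on V.
[cite: BalabanImbrieJaffe1985, (4.1.3) p.310] -/
theorem moment_integrable {V : Submodule ℝ E} {D : E →ₗ[ℝ] F} (hD : ∀ v : V, D (v : E) = 0 → v = 0) :
    Integrable (fun v : V => Real.exp (-(1 / 2) * ‖D (v : E)‖ ^ 2) • (v : E)) := by
  set S : V →ₗ[ℝ] F := D ∘ₗ V.subtype with hS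
  have hSinj : Function.Injective S := injective_S hD
  obtain ⟨K, hK0, hK⟩ := exists_bound hSinj
  -- majorant: K · e^{−¼‖Sv‖²} = K · e^{−½‖S'v‖²}, S' = (√2)⁻¹ S
  set S' : V →ₗ[ℝ] F := (Real.sqrt 2)⁻¹ • S with hS'
  have hS'inj : Function.Injective S' := by
    intro v w h
    apply hSinj
    have h2 : (Real.sqrt 2)⁻¹ ≠ 0 := inv_ne_zero (Real.sqrt_ne_zero'.2 (by norm_num))
    simpa [hS', h2] using h
  have hmaj : Integrable (fun v : V => K * Real.exp (-(1 / 2) * ‖S' v‖ ^ 2)) :=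
    (partition_integrable hS'inj).const_mul K
  refine hmaj.mono' ?_ (Filter.Eventually.of_forall fun v => ?_)
  · have hc : Continuous fun v : V => Real.exp (-(1 / 2) * ‖D (v : E)‖ ^ 2) • (v : E) := by
      have hD' : Continuous fun v : V => D (v : E) :=
        (D.continuous_of_finiteDimensional).comp continuous_subtype_val
      exact ((continuous_const.mul ((continuous_norm.comp hD').pow 2)).rexp).smul continuous_subtype_val
    exact hc.aestronglyMeasurable
  · have hSq : ‖S' v‖ ^ 2 = (1 / 2) * ‖S v‖ ^ 2 := by
      simp only [hS', LinearMap.smul_apply, norm_smul, norm_inv, Real.norm_eq_abs,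
        abs_of_pos (Real.sqrt_pos.2 (by norm_num : (0:ℝ) < 2)), mul_pow, inv_pow, Real.sq_sqrt (by norm_num : (0:ℝ) ≤ 2)]
      ring
    have hSv : D (v : E) = S v := rfl
    rw [norm_smul, Real.norm_eq_abs, abs_of_pos (Real.exp_pos _), hSv, hSq]
    have hnv : ‖(v : E)‖ = ‖v‖ := rfl
    rw [hnv]
    set e1 := Real.exp (-(‖S v‖ ^ 2 / 4)) with he1
    set e2 := Real.exp (-(1 / 2) * ((1 / 2) * ‖S v‖ ^ 2)) with he2
    have hsplit : Real.exp (-(1 / 2) * ‖S v‖ ^ 2) = e1 * e2 := by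
      rw [he1, he2, ← Real.exp_add]; congr 1; ring
    have hb : e1 * ‖v‖ ≤ K :=
      calc e1 * ‖v‖ ≤ e1 * (K * ‖S v‖) := mul_le_mul_of_nonneg_left (hK v) (Real.exp_pos _).le
        _ = K * (‖S v‖ * e1) := by ring
        _ ≤ K * 1 := mul_le_mul_of_nonneg_left (mul_exp_neg_sq_le ‖S v‖) hK0
        _ = K := mul_one K
    calc Real.exp (-(1 / 2) * ‖S v‖ ^ 2) * ‖v‖ = (e1 * ‖v‖) * e2 := by rw [hsplit]; ring
      _ ≤ K * e2 := mul_le_mul_of_nonneg_right hb (Real.exp_pos _).le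

variable [FiniteDimensional ℝ F]

/-- **(4.1.4) evaluated**: `Z_{k,Ax}(B) = e^{−½‖∂M‖²}·Z_{k,Ax}`, M the minimizing configuration, `Z_{k,Ax}` the normalization
of (4.1.1) (no zero modes). [cite: BalabanImbrieJaffe1985, (4.1.4) p.310] -/
theorem Zax_eq {V : Submodule ℝ E} {D : E →ₗ[ℝ] F} (hD : ∀ v : V, D (v : E) = 0 → v = 0) (A₀ : E) :
    Zax V D A₀ = Real.exp (-(1 / 2) * ‖D (minimizer V D A₀)‖ ^ 2) * Z V D := by
  rw [← Zax_congr V D (minimizer_sub_mem V D A₀)]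
  unfold Zax Z
  rw [← integral_const_mul]
  refine integral_congr_ae (Filter.Eventually.of_forall fun v => ?_)
  simp only
  rw [norm_sq_D_minimizer_add hD A₀ v, mul_add, Real.exp_add]

/-- `Z_{k,Ax}(B) > 0` (no zero modes). [cite: BalabanImbrieJaffe1985, (4.1.4) p.310] -/
theorem Zax_pos {V : Submodule ℝ E} {D : E →ₗ[ℝ] F} (hD : ∀ v : V, D (v : E) = 0 → v = 0) (A₀ : E) :
    0 < Zax V D A₀ := by
  rw [Zax_eq hD]
  exact mul_pos (Real.exp_pos _) (isAxialPropagator_axialPropagator V D hD).2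

/-- **(4.1.3) evaluated — `H_{k,Ax}B` IS the minimizing configuration**: the Gaussian mean over the constraint class equals
`A₀ − G_{k,Ax}(∂^*∂A₀)` (no zero modes of ∂ on V).  This is the computation the paper prints for (5.3.1), p. 317, verbatim:
*"This identity follows by inspecting the definition (4.1.3) after the translation A = A′ + Q^{s*}_kB. … The second term
yields Q^{s*}_kB. In the first term we translate to the minimum of the quadratic form which is G_{k,Ax}∂^*Q^{e*}_k∂B. We see
this by integrating."* — here for a general representative A₀ in place of Q^{s*}_kB. [cite: BalabanImbrieJaffe1985, (4.1.3) p.310] -/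
theorem Hax_eq_minimizer {V : Submodule ℝ E} {D : E →ₗ[ℝ] F} (hD : ∀ v : V, D (v : E) = 0 → v = 0) (A₀ : E) :
    Hax V D A₀ = minimizer V D A₀ := by
  set M := minimizer V D A₀ with hM
  rw [← Hax_congr V D (minimizer_sub_mem V D A₀)]
  unfold Hax
  rw [Zax_eq hD, ← hM, minimizer_minimizer hD, ← hM]
  -- split the integrand at the minimum
  have hint : ∀ v : V, Real.exp (-(1 / 2) * ‖D (M + (v : E))‖ ^ 2) • (M + (v : E)) =
      Real.exp (-(1 / 2) * ‖D M‖ ^ 2) • (Real.exp (-(1 / 2) * ‖D (v : E)‖ ^ 2) • M +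
        Real.exp (-(1 / 2) * ‖D (v : E)‖ ^ 2) • (v : E)) := by
    intro v
    have h := norm_sq_D_minimizer_add hD M v
    rw [minimizer_minimizer hD, ← hM] at h
    rw [h, mul_add, Real.exp_add, ← smul_add, mul_smul]
  simp_rw [hint]
  have hi1 : Integrable (fun v : V => Real.exp (-(1 / 2) * ‖D (v : E)‖ ^ 2) • M) :=
    (partition_integrable (injective_S hD)).smul_const M
  rw [integral_smul, integral_add hi1 (moment_integrable hD), moment_zero V D, add_zero, integral_smul_const]
  have hZ : (∫ v : V, Real.exp (-(1 / 2) * ‖D (v : E)‖ ^ 2)) = Z V D := rfl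
  rw [hZ, smul_smul, smul_smul]
  have hne : Real.exp (-(1 / 2) * ‖D M‖ ^ 2) * Z V D ≠ 0 :=
    mul_ne_zero (Real.exp_pos _).ne' (isAxialPropagator_axialPropagator V D hD).2.ne'
  have h1 : (Real.exp (-(1 / 2) * ‖D M‖ ^ 2) * Z V D)⁻¹ * Real.exp (-(1 / 2) * ‖D M‖ ^ 2) * Z V D = 1 := by
    rw [mul_assoc, inv_mul_cancel₀ hne]
  rw [h1, one_smul]

/-- **(4.1.5)** verbatim: *"Note that by definition Q_kH_{k,Ax}B = B. (4.1.5)"* — for every linear map `Q` vanishing on the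
constraint subspace V (in (4.1.3): `Q_k`, since `V ⊆ {Q_kA = 0}`), `Q(H_{k,Ax}B) = Q(A₀) (= B)`. From `H − A₀ ∈ V` (no zero
modes). [cite: BalabanImbrieJaffe1985, (4.1.5) p.310] -/
theorem eq415 {V : Submodule ℝ E} {D : E →ₗ[ℝ] F} (hD : ∀ v : V, D (v : E) = 0 → v = 0) (A₀ : E)
    {G' : Type*} [AddCommGroup G'] [Module ℝ G'] (Q : E →ₗ[ℝ] G') (hQ : ∀ v : V, Q (v : E) = 0) :
    Q (Hax V D A₀) = Q A₀ := by
  rw [Hax_eq_minimizer hD]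
  have h := hQ ⟨minimizer V D A₀ - A₀, minimizer_sub_mem V D A₀⟩
  simp only [map_sub] at h
  exact sub_eq_zero.1 h

/-- `H_{k,Ax}B` lies in the constraint class of its representative: `H − A₀ ∈ V` (so it keeps the gauge δ_{k,Ax} and the
average `Q_kA = B`). [cite: BalabanImbrieJaffe1985, (4.1.5) p.310] -/
theorem Hax_sub_mem {V : Submodule ℝ E} {D : E →ₗ[ℝ] F} (hD : ∀ v : V, D (v : E) = 0 → v = 0) (A₀ : E) :
    Hax V D A₀ - A₀ ∈ V := by
  rw [Hax_eq_minimizer hD]; exact minimizer_sub_mem V D A₀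

/-- **`H_{k,Ax}` maps B into a minimizing configuration** (p. 310): `‖∂(H_{k,Ax}B)‖ ≤ ‖∂A‖` for every A of the constraint
class, with equality only at `A = H_{k,Ax}B`. [cite: BalabanImbrieJaffe1985, (4.1.3) p.310] -/
theorem norm_D_Hax_le {V : Submodule ℝ E} {D : E →ₗ[ℝ] F} (hD : ∀ v : V, D (v : E) = 0 → v = 0) (A₀ : E)
    {A : E} (hA : A - A₀ ∈ V) : ‖D (Hax V D A₀)‖ ≤ ‖D A‖ := by
  rw [Hax_eq_minimizer hD]; exact norm_D_minimizer_le hD A₀ hA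

/-- Uniqueness of the minimum: `‖∂A‖ ≤ ‖∂(H_{k,Ax}B)‖` on the class forces `A = H_{k,Ax}B`. [cite: BalabanImbrieJaffe1985, (4.1.3) p.310] -/
theorem eq_Hax_of_norm_le {V : Submodule ℝ E} {D : E →ₗ[ℝ] F} (hD : ∀ v : V, D (v : E) = 0 → v = 0) (A₀ : E)
    {A : E} (hA : A - A₀ ∈ V) (hle : ‖D A‖ ≤ ‖D (Hax V D A₀)‖) : A = Hax V D A₀ := by
  rw [Hax_eq_minimizer hD] at hle ⊢; exact eq_minimizer_of_norm_le hD A₀ hA hle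

/-- **The printed (5.3.1) shape** `H_{k,Ax}B = Q^{s*}_kB − G_{k,Ax}∂^*Q^{e*}_k∂B`, abstractly: for a right inverse `Qs` of the
average (`A₀ = Qs B` a representative of the class of B) and any `T` with `∂(Qs B) = T B` (in print `T = Q^{e*}_k∂`, by
`∂Q^{s*}_k = Q^{e*}_k∂`), `H_{k,Ax}B = Qs B − G_{k,Ax}∂^*(T B)`. [cite: BalabanImbrieJaffe1985, (5.3.1) p.317] -/
theorem eq531_shape {V : Submodule ℝ E} {D : E →ₗ[ℝ] F} (hD : ∀ v : V, D (v : E) = 0 → v = 0)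
    {B' : Type*} (Qs : B' → E) (T : B' → F) (hT : ∀ B, D (Qs B) = T B) (B : B') :
    Hax V D (Qs B) = Qs B - axialPropagator V D (LinearMap.adjoint D (T B)) := by
  rw [Hax_eq_minimizer hD, minimizer, hT]

end Gaussian

/-! ## §3  (4.1.3)–(4.1.5) on the tori of the series' lattice calculus -/

section Torus

open Literature.MathematicalPhysics.QuantumFieldTheory.Balaban1983to89
open LatticeFieldCalculus

variable {P : Params}

/-- The no-zero-modes claim of p. 309, transported to the Euclidean space `BondSpace P`. [cite: BalabanImbrieJaffe1985, §4.1 p.309] -/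
theorem noZeroModes_V411 {w : ℝ} (hw : 0 < w) (c : ℝ) (k : ℕ)
    (hD : ∀ A : VecField P 0 ℝ, A ∈ (constraint411 k : Submodule ℝ (VecField P 0 ℝ)) → (∀ p, curl c A p = 0) → A = 0)
    (v : V411 P k) (hv : curlOp (P := P) w c (v : BondSpace P) = 0) : v = 0 := by
  have hmem := (mem_V411 k (v : BondSpace P)).1 v.2
  have hcurl : ∀ p, curl c ((toE P).symm (v : BondSpace P)) p = 0 := by
    intro p
    have h := congrArg (fun u : PlaqSpace P => u p) hv
    have hsw : Real.sqrt w ≠ 0 := (Real.sqrt_pos.2 hw).ne'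
    have h' : Real.sqrt w * curl c ((toE P).symm (v : BondSpace P)) p = 0 := h
    simpa [hsw] using h'
  have hA := hD _ ((mem_constraint411 k _).2 hmem) hcurl
  have : (v : BondSpace P) = 0 := by
    rw [← (toE P).apply_symm_apply (v : BondSpace P), hA, map_zero]
  exact Subtype.ext this

/-- **`H_{k,Ax}` on the torus**, as a map on representatives `A₀` of the constraint classes `{A : δ_{k,Ax}(A), Q_kA = Q_kA₀}`
(weights: `⟨·,·⟩ = bondPairing w`, `½‖∂A‖² = curlAction w c`). [cite: BalabanImbrieJaffe1985, (4.1.3) p.310] -/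
def torusHax (w c : ℝ) (k : ℕ) (A₀ : VecField P 0 ℝ) : VecField P 0 ℝ :=
  (toE P).symm (Hax (V411 P k) (curlOp (P := P) w c) (toE P A₀))

/-- `Z_{k,Ax}(B)` on the torus. [cite: BalabanImbrieJaffe1985, (4.1.4) p.310] -/
def torusZax (w c : ℝ) (k : ℕ) (A₀ : VecField P 0 ℝ) : ℝ :=
  Zax (V411 P k) (curlOp (P := P) w c) (toE P A₀)

/-- (4.1.4) on the torus reads verbatim: `Z_{k,Ax}(B) = ∫_{A₀ + V} e^{−½Σ_p η^d|(∂A)(p)|²} dA`. [cite: BalabanImbrieJaffe1985, (4.1.4) p.310] -/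
theorem torusZax_eq {w : ℝ} (hw : 0 ≤ w) (c : ℝ) (k : ℕ) (A₀ : VecField P 0 ℝ) :
    torusZax w c k A₀ = ∫ v : V411 P k, Real.exp (-curlAction w c (A₀ + (toE P).symm (v : BondSpace P))) := by
  unfold torusZax Zax
  refine integral_congr_ae (Filter.Eventually.of_forall fun v => ?_)
  simp only
  rw [neg_mul, half_norm_curlOp_sq hw c (toE P A₀ + (v : BondSpace P)), map_add, LinearEquiv.symm_apply_apply]

/-- (4.1.3) on the torus reads verbatim: `H_{k,Ax}B = Z_{k,Ax}(B)⁻¹ ∫_{A₀ + V} A e^{−½Σ_p η^d|(∂A)(p)|²} dA`.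
[cite: BalabanImbrieJaffe1985, (4.1.3) p.310] -/
theorem torusHax_eq_integral {w : ℝ} (hw : 0 ≤ w) (c : ℝ) (k : ℕ) (A₀ : VecField P 0 ℝ) :
    toE P (torusHax w c k A₀) = (torusZax w c k A₀)⁻¹ •
      ∫ v : V411 P k, Real.exp (-curlAction w c (A₀ + (toE P).symm (v : BondSpace P))) • (toE P A₀ + (v : BondSpace P)) := by
  unfold torusHax Hax torusZax
  rw [LinearEquiv.apply_symm_apply]
  congr 1
  refine integral_congr_ae (Filter.Eventually.of_forall fun v => ?_)
  simp only
  rw [neg_mul, half_norm_curlOp_sq hw c (toE P A₀ + (v : BondSpace P)), map_add, LinearEquiv.symm_apply_apply]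

/-- `H_{k,Ax}` on the torus depends only on the constraint class of the representative. [cite: BalabanImbrieJaffe1985, (4.1.3) p.310] -/
theorem torusHax_congr (w c : ℝ) (k : ℕ) {A₀ A₁ : VecField P 0 ℝ}
    (h : A₁ - A₀ ∈ (constraint411 k : Submodule ℝ (VecField P 0 ℝ))) : torusHax w c k A₁ = torusHax w c k A₀ := by
  unfold torusHax
  have h' : toE P A₁ - toE P A₀ ∈ V411 P k := by
    rw [← map_sub]
    exact Submodule.mem_map_of_mem h
  rw [Hax_congr (V411 P k) (curlOp (P := P) w c) h']

/-- **(4.1.5) on the torus**: `Q_k(H_{k,Ax}B) = B` — the k-fold average of `H_{k,Ax}` of a representative `A₀` is that of `A₀`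
(`= B`), and `H_{k,Ax}B` satisfies the axial gauge conditions δ_{k,Ax} whenever the representative does (no zero modes, `w = η^d > 0`).
[cite: BalabanImbrieJaffe1985, (4.1.5) p.310] -/
theorem torus_eq415 {w : ℝ} (hw : 0 < w) (c : ℝ) (k : ℕ)
    (hD : ∀ A : VecField P 0 ℝ, A ∈ (constraint411 k : Submodule ℝ (VecField P 0 ℝ)) → (∀ p, curl c A p = 0) → A = 0)
    (A₀ : VecField P 0 ℝ) :
    bondAvgIter k (torusHax w c k A₀) = bondAvgIter k A₀ ∧ (deltaAx k A₀ → deltaAx k (torusHax w c k A₀)) := by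
  have hD' := noZeroModes_V411 hw c k hD
  have hmem : Hax (V411 P k) (curlOp (P := P) w c) (toE P A₀) - toE P A₀ ∈ V411 P k := Hax_sub_mem hD' _
  have hmem' := (mem_V411 k _).1 hmem
  rw [map_sub, LinearEquiv.symm_apply_apply] at hmem'
  have hsplit : torusHax w c k A₀ = A₀ + ((toE P).symm (Hax (V411 P k) (curlOp (P := P) w c) (toE P A₀)) - A₀) := by
    unfold torusHax; abel
  refine ⟨?_, fun hA₀ => ?_⟩
  · rw [hsplit, bondAvgIter_add, hmem'.1, add_zero]
  · rw [hsplit]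
    intro j hj
    rw [bondAvgIter_add]
    exact isAxial_add (hA₀ j hj) (hmem'.2 j hj)

/-- **The minimizing property on the torus**: `½Σ_p η^d|(∂H_{k,Ax}B)(p)|² ≤ ½Σ_p η^d|(∂A)(p)|²` for every A of the constraint
class of the representative (δ_{k,Ax}(A − A₀), Q_k(A − A₀) = 0). [cite: BalabanImbrieJaffe1985, (4.1.3) p.310] -/
theorem torus_minimizes {w : ℝ} (hw : 0 < w) (c : ℝ) (k : ℕ)
    (hD : ∀ A : VecField P 0 ℝ, A ∈ (constraint411 k : Submodule ℝ (VecField P 0 ℝ)) → (∀ p, curl c A p = 0) → A = 0)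
    (A₀ : VecField P 0 ℝ) {A : VecField P 0 ℝ} (hA : A - A₀ ∈ (constraint411 k : Submodule ℝ (VecField P 0 ℝ))) :
    curlAction w c (torusHax w c k A₀) ≤ curlAction w c A := by
  have hD' := noZeroModes_V411 hw c k hD
  have hA' : toE P A - toE P A₀ ∈ V411 P k := by
    rw [← map_sub]; exact Submodule.mem_map_of_mem hA
  have h := norm_D_Hax_le hD' (toE P A₀) hA'
  have h2 : ‖curlOp (P := P) w c (Hax (V411 P k) (curlOp (P := P) w c) (toE P A₀))‖ ^ 2 ≤
      ‖curlOp (P := P) w c (toE P A)‖ ^ 2 := pow_le_pow_left₀ (norm_nonneg _) h 2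
  have h3 := mul_le_mul_of_nonneg_left h2 (by norm_num : (0:ℝ) ≤ 1 / 2)
  rw [half_norm_curlOp_sq hw.le, half_norm_curlOp_sq hw.le, LinearEquiv.symm_apply_apply] at h3
  exact h3

/-- `Z_{k,Ax}(B) > 0` on the torus (no zero modes, `w > 0`). [cite: BalabanImbrieJaffe1985, (4.1.4) p.310] -/
theorem torusZax_pos {w : ℝ} (hw : 0 < w) (c : ℝ) (k : ℕ)
    (hD : ∀ A : VecField P 0 ℝ, A ∈ (constraint411 k : Submodule ℝ (VecField P 0 ℝ)) → (∀ p, curl c A p = 0) → A = 0)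
    (A₀ : VecField P 0 ℝ) : 0 < torusZax w c k A₀ :=
  Zax_pos (noZeroModes_V411 hw c k hD) _

end Torus

end

end Literature.MathematicalPhysics.QuantumFieldTheory.BalabanImbrieJaffe1984to88.BIJ85AxialMinimizer413
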